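import Summits.ResolutionOfSingularities.ResolutionOfSingularities.Theorems.MarkedTransferCampaignW31StableTowerResidual
import HarnessLib

/-!
# [OURS · L1 W3.6 / W3.1] The W3.6 consumer TARGET SHELL: «⟨UscCut⟩ ∧ ⟨StableTower b₀ ≤ b⟩ ⇒ Ě exists (with Inv-constant centre data)»,
# CLASS-RESTRICTED and LEVEL-BOUNDED — `CampaignW36.HatUscCutOn 𝒞`, `HatStableTowerLEOn 𝒞 b`, `CoreFocusExistsOn 𝒞` and their kernel links

Cell `res-hironaka`, rung L, slots W3.6 («ord-pow cut», K3.6 = ALIVE OF RECORD) / W3.1 aftercare — OURS typer o4, statement-only lane.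
Director-resolution g3, K3.6 RULING 2026-08-27T02:13:30Z (2)–(3): «res-plan-2 + res-adj-3 NAME THE CONSUMER by 08:00Z: the exact R12/12a
residual statement the ord-pow/stable-tower cut discharges, as an OURS target typed by o4 (shape: “⟨UscCut⟩ ∧ ⟨StableTower b₀ ≤ 2⟩ ⇒ Ě exists
with Inv-constant regular-or-core-focused centre data”, quantified over the class the two specimens represent — NOT a blanket ∀ …); IF the
consumer is named and o4 has the target typed (or a typing slot booked) by the 08:00Z check-in, the successor director may WAKE s36 ×2». THIS
FILE is the TYPING SLOT: the director's shape with the CLASS `𝒞` (a predicate on ideal exponents, to be NAMED by res-plan-2 / res-adj-3 —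
e.g. the family the specimens (A) `E_A = (z² + (y² − x³)^N, 2)` ⊂ 𝔸³ and (B) `E_B = ((w²) + (xy, yz, zx)^M, 2)` ⊂ 𝔸⁴ represent) and the LEVEL
BOUND `b` (the ruling's `2`) as PARAMETERS; the instance is one `def` away once the class is named. Companion of p485977
(`…W31StableTowerResidual.lean`: the blanket residual `CampaignW31.HatStableTowerPos`).

* OURS defs (desk lanes), binders of the GUARDED halves (p480937) plus the class guard `𝒞 (baseHike E)` — the class is read on `Ê`, the
  exponent whose `Σ̄_max` the specimens describe:
  `CampaignW36.HatUscCutOn 𝒞 IsEdgeData A n` (⟨UscCut⟩ on the class: `closure Σ_max ∩ Sing(Ê)_cl = Σ_max`, res-type-010's first conjunct),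
  `CampaignW36.HatStableTowerLEOn 𝒞 IsEdgeData b A n` (⟨StableTower b₀ ≤ b⟩ on the class: the tower over `Σ̄_max` is stable at some level
  `0 < b₀ ≤ b`), `CampaignW36.CoreFocusExistsOn 𝒞 IsEdgeData A n` (the R12/12a apex ON THE CLASS: `∃ Ě, IsCoreFocus ℘ (invInst Ê ed) Ê Ě` —
  row 010d's conclusion, guards of the Hat family); `p`-slices `CampaignW36HatStableTowerLEOnI 𝒞 b p`, `CampaignW36CoreFocusExistsOnI 𝒞 p`.
* Kernel links (pure logic over the typed carriers + res-type-010's `exists_isCoreFocus_iff_closure_ambient`): THE DIRECTOR'S IMPLICATION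
  `HatUscCutOn 𝒞 ∧ HatStableTowerLEOn 𝒞 b ⇒ CoreFocusExistsOn 𝒞` (`coreFocusExistsOn_of_uscCut_of_stableTowerLE`) — a THEOREM for every class
  and level, so the CANDIDATE content of the target is the premise pair on the class; ⟨UscCut⟩ on EVERY class from slot W3.1
  (`hatUscCutOn_of_hatStratumClosedPos`, `…_of_invmaxClosed`); hence FROM W3.1: `HatStableTowerLEOn 𝒞 b ⇒ CoreFocusExistsOn 𝒞`; conversely
  `CoreFocusExistsOn 𝒞 ⇒` ⟨StableTower⟩ on the class at SOME level (`hatStableTowerOn_of_coreFocusExistsOn`, no bound — the bound `b` is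
  what the W3.6 mechanism adds); monotonicity in `𝒞` and `b`; the blanket forms are the class `⊤` (`hatStableTowerPos_iff_on_univ`);
  «Inv-constant centre data» is AUTOMATIC: on `Sing(Ě)_cl` the reading `Inv` is constant `= Inv_max` (`inv_le_inv_of_mem_sing_coreFocus`, from (43)).

HONEST FRAMING. Everything here is OURS; NOTHING below is a statement of H. Hironaka's manuscript [Hironaka2017] (lit key
`paper:url-3343fd9e678b`; p.30 l.4–9 prints no existence argument for `Ě`); nothing of it is asserted. `HatStableTowerLEOn 𝒞 b` is a CANDIDATE
premise whose truth value depends on the class: CERTIFIED at the two K3.6 specimens (res-L1-k36 02:04:05Z, j265296 + p484649; res-type-010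
`SpecimenB.specimenB_isCoreFocus` p484139: level `1` at `E_A`, level `2` at `E_B`, both modulo Inv-constancy on `Sing(Ê)_cl`), UNKNOWN on any
wider class until the class is named and proved. VACUITY SELF-CHECK (T-lint): every `…On 𝒞` decl is trivially true for `𝒞 = ⊥` and agrees with
its blanket sibling for `𝒞 = ⊤`; vacuous where no certified edge data exist (as all Hat decls); `CoreFocusExistsOn` is NOT made trivially true
by the class guard (it asks for an actual `Ě`). The class is read on `Ê = baseHike E` (design choice recorded: the specimens are given as
maximum-base-hiked exponents; a class read on `E` is the special case `𝒞 ∘ baseHike`). AI bookkeeping; weaker than expert review.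

## References (context; nothing below is used as a premise)
* H. Hironaka, ms. 2017-03-23, §6.2 p.30 l.4–9 (Eq. (43)) — scope only, under adjudication. [Hironaka2017]
* Cell records: director-resolution K3.6 RULING 2026-08-27T02:13:30Z; res-L1-k36 KILL-TEST K3.6 ALIVE 02:04:05Z; res-adj-3 GAP-AMEND R12 12a
  01:18Z / GAP-NOTE 02:08:44Z; res-type-010 p480139 / p484139; o4 p480937 / p485977.
-/

noncomputable section

set_option linter.dupNamespace false -- mandated namespace of this single-conjunct summit

open _root_.AlgebraicGeometry _root_.TopologicalSpace _root_.CategoryTheory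

namespace Summit.ResolutionOfSingularities.ResolutionOfSingularities.Theorems

open Literature.AlgebraicGeometry.Resolution
open Literature.AlgebraicGeometry.Hironaka2017
open Literature.AlgebraicGeometry.Hironaka2017.S02Preliminaries
open Literature.AlgebraicGeometry.Hironaka2017.S04CharAlgebra
open Literature.AlgebraicGeometry.Hironaka2017.S06BaseHike
open Literature.AlgebraicGeometry.Hironaka2017.Datum

universe u

namespace CampaignW36

section OnClass

variable (𝒞 : ∀ ⦃W : Scheme.{u}⦄, IdealExponent W → Set W → Prop)
  (IsEdgeData : ∀ ⦃X : Scheme.{u}⦄ ⦃p n : ℕ⦄ (E : IdealExponent X) (ξ : X), EdgeDatumAt p n E ξ → Prop)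

/-- **[OURS · L1 W3.6] `CampaignW36.HatUscCutOn 𝒞` — ⟨UscCut⟩ ON THE CLASS `𝒞`**: replaces the role of the presupposition of Eq. (43)
p.30 l.8 (the `Inv_max`-stratum is a closed singular locus) for the exponents `Ê` in the class; NOT a statement of the manuscript. For every
standard `E` on `A.Z` with `0 < Ê.b`, `𝒞 Ê` (`Ê = baseHike E`) and every certified family `ed` of edge data of `Ê` on `Sing(Ê)_cl`:
`closure Σ_max ∩ Sing(Ê)_cl = Σ_max` (res-type-010's first conjunct; `Σ_max = invmaxStratum (Sing(Ê)_cl) (invField Ê ed)`). FOLLOWS on every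
class from slot W3.1 (`hatUscCutOn_of_invmaxClosed`). [folklore] -/
def HatUscCutOn {p : ℕ} [Fact p.Prime] {K : Type u} [Field K] [CharP K p] [PerfectField K] (A : AmbientDatum p K) (n : ℕ) :
    Prop :=
  ∀ (E : IdealExponent A.Z) (ed : EdgeDataOn p n (baseHike E)), E.IsStandard → 0 < (baseHike E).b →
    IsEdgeDataOn IsEdgeData (baseHike E) ed →
    𝒞 (baseHike E) (invmaxStratum ((baseHike E).sing ∩ S02Preliminaries.closedPoints A.Z) (invField (baseHike E) ed)) →
      closure (invmaxStratum ((baseHike E).sing ∩ S02Preliminaries.closedPoints A.Z) (invField (baseHike E) ed)) ∩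
          ((baseHike E).sing ∩ S02Preliminaries.closedPoints A.Z) =
        invmaxStratum ((baseHike E).sing ∩ S02Preliminaries.closedPoints A.Z) (invField (baseHike E) ed)

/-- **[OURS · L1 W3.6] `CampaignW36.HatStableTowerLEOn 𝒞 b` — ⟨StableTower b₀ ≤ b⟩ ON THE CLASS `𝒞`** (the director's «⟨StableTower b₀ ≤ 2⟩»
with the bound a parameter): replaces the role of nothing printed (no existence argument for `Ě`, p.30 l.4–9); NOT a statement of the
manuscript. For every standard `E` with `0 < Ê.b`, `𝒞 Ê` and every certified `ed`: res-type-010's tower `b′ ↦ focusAt Ê Σ̄_max b′` over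
`Σ̄_max = invmaxClosure (Sing(Ê)_cl) (invField Ê ed)` is stable at some level `b₀` with `0 < b₀ ≤ b`. CANDIDATE premise — certified at the K3.6
specimens (level `1` at `E_A`, level `2` at `E_B`, modulo Inv-constancy), unknown beyond a named class. Class-restricted, level-bounded form of
`CampaignW31.HatStableTowerPos` (p485977). [folklore] -/
def HatStableTowerLEOn (b : ℕ) {p : ℕ} [Fact p.Prime] {K : Type u} [Field K] [CharP K p] [PerfectField K] (A : AmbientDatum p K)
    (n : ℕ) : Prop :=
  ∀ (E : IdealExponent A.Z) (ed : EdgeDataOn p n (baseHike E)), E.IsStandard → 0 < (baseHike E).b →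
    IsEdgeDataOn IsEdgeData (baseHike E) ed →
    𝒞 (baseHike E) (invmaxStratum ((baseHike E).sing ∩ S02Preliminaries.closedPoints A.Z) (invField (baseHike E) ed)) →
      ∃ b₀ : ℕ, 0 < b₀ ∧ b₀ ≤ b ∧ StableAt (baseHike E)
        (CampaignW31.invmaxClosure ((baseHike E).sing ∩ S02Preliminaries.closedPoints A.Z) (invField (baseHike E) ed)) b₀

/-- **[OURS · L1 W3.6] `CampaignW36.CoreFocusExistsOn 𝒞` — THE R12/12a APEX ON THE CLASS `𝒞`** («Ě exists», row 010d's conclusion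
`∃ Ě, IsCoreFocus ℘ (invInst Ê ed) Ê Ě` of `S06BaseHike.U30_2_R2_inst`, in the guard shape of the Hat family + the class guard): replaces the
role of the unproved existence sentence p.30 l.5–9 on the class; NOT a statement of the manuscript. «Inv-constant centre data» is automatic
(`inv_le_inv_of_mem_sing_coreFocus`). [folklore] -/
def CoreFocusExistsOn {p : ℕ} [Fact p.Prime] {K : Type u} [Field K] [CharP K p] [PerfectField K] (A : AmbientDatum p K)
    (n : ℕ) : Prop :=
  ∀ (E : IdealExponent A.Z) (ed : EdgeDataOn p n (baseHike E)), E.IsStandard → 0 < (baseHike E).b →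
    IsEdgeDataOn IsEdgeData (baseHike E) ed →
    𝒞 (baseHike E) (invmaxStratum ((baseHike E).sing ∩ S02Preliminaries.closedPoints A.Z) (invField (baseHike E) ed)) →
      ∃ Echeck : IdealExponent A.Z, IsCoreFocus S04CharAlgebra.pAlg (invInst (baseHike E) ed) (baseHike E) Echeck

variable {𝒞 IsEdgeData}

/-- **THE DIRECTOR'S IMPLICATION IS A THEOREM (every class, every bound)**: ⟨UscCut⟩ ∧ ⟨StableTower b₀ ≤ b⟩ on `𝒞` ⇒ `Ě` exists on `𝒞`
(res-type-010's `exists_isCoreFocus_iff_closure_ambient`, p480139). So the candidate content of the W3.6 target is the premise pair. [folklore] -/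
theorem coreFocusExistsOn_of_uscCut_of_stableTowerLE {b : ℕ} {p : ℕ} [Fact p.Prime] {K : Type u} [Field K] [CharP K p]
    [PerfectField K] {A : AmbientDatum p K} {n : ℕ} (h₁ : HatUscCutOn 𝒞 IsEdgeData A n)
    (h₂ : HatStableTowerLEOn 𝒞 IsEdgeData b A n) : CoreFocusExistsOn 𝒞 IsEdgeData A n := by
  intro E ed hE hb hed hC
  obtain ⟨b₀, hb₀, -, hst⟩ := h₂ E ed hE hb hed hC
  exact (exists_isCoreFocus_iff_closure_ambient A (invInst (baseHike E) ed) (baseHike E) hb).mpr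
    ⟨h₁ E ed hE hb hed hC, b₀, hb₀, hst⟩

/-- Converse direction (no level bound): `Ě` exists on `𝒞` ⇒ ⟨UscCut⟩ on `𝒞` and ⟨StableTower⟩ on `𝒞` at SOME positive level — the bound
`b` is exactly what the W3.6 mechanism adds to the bare residual. [folklore] -/
theorem hatStableTowerOn_of_coreFocusExistsOn {p : ℕ} [Fact p.Prime] {K : Type u} [Field K] [CharP K p] [PerfectField K]
    {A : AmbientDatum p K} {n : ℕ} (h : CoreFocusExistsOn 𝒞 IsEdgeData A n) (E : IdealExponent A.Z)
    (ed : EdgeDataOn p n (baseHike E)) (hE : E.IsStandard) (hb : 0 < (baseHike E).b)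
    (hed : IsEdgeDataOn IsEdgeData (baseHike E) ed)
    (hC : 𝒞 (baseHike E) (invmaxStratum ((baseHike E).sing ∩ S02Preliminaries.closedPoints A.Z) (invField (baseHike E) ed))) :
    closure (invmaxStratum ((baseHike E).sing ∩ S02Preliminaries.closedPoints A.Z) (invField (baseHike E) ed)) ∩
          ((baseHike E).sing ∩ S02Preliminaries.closedPoints A.Z) =
        invmaxStratum ((baseHike E).sing ∩ S02Preliminaries.closedPoints A.Z) (invField (baseHike E) ed) ∧
      ∃ b₀ : ℕ, 0 < b₀ ∧ StableAt (baseHike E)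
        (CampaignW31.invmaxClosure ((baseHike E).sing ∩ S02Preliminaries.closedPoints A.Z) (invField (baseHike E) ed)) b₀ :=
  (exists_isCoreFocus_iff_closure_ambient A (invInst (baseHike E) ed) (baseHike E) hb).mp (h E ed hE hb hed hC)

/-- ⟨UscCut⟩ on every class from the GUARDED closedness half (p480937), via p476257's `invmaxClosure_inter_eq`. [folklore] -/
theorem hatUscCutOn_of_hatStratumClosedPos {p : ℕ} [Fact p.Prime] {K : Type u} [Field K] [CharP K p] [PerfectField K]
    {A : AmbientDatum p K} {n : ℕ} (h : CampaignW31.HatStratumClosedPos IsEdgeData A n) : HatUscCutOn 𝒞 IsEdgeData A n :=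
  fun E ed hE hb hed _ => CampaignW31.invmaxClosure_inter_eq (h E ed hE hb hed)

/-- **⟨UscCut⟩ on every class FROM SLOT W3.1** (`CampaignW31InvmaxClosed IsEdgeData`, p463247 / k31's assembly p467881). [folklore] -/
theorem hatUscCutOn_of_invmaxClosed (hW31 : CampaignW31InvmaxClosed.{u} IsEdgeData) {p : ℕ} [Fact p.Prime] (K : Type u) [Field K]
    [CharP K p] [PerfectField K] (A : AmbientDatum p K) (n : ℕ) : HatUscCutOn 𝒞 IsEdgeData A n :=
  hatUscCutOn_of_hatStratumClosedPos (CampaignW31.hatStratumClosedPos_of_invmaxClosed hW31 K A n)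

/-- **FROM W3.1, the target reduces to ⟨StableTower b₀ ≤ b⟩ on the class**: `CampaignW31InvmaxClosed ∧ HatStableTowerLEOn 𝒞 b ⇒
CoreFocusExistsOn 𝒞`. [folklore] -/
theorem coreFocusExistsOn_of_invmaxClosed_of_stableTowerLE (hW31 : CampaignW31InvmaxClosed.{u} IsEdgeData) {b : ℕ} {p : ℕ}
    [Fact p.Prime] {K : Type u} [Field K] [CharP K p] [PerfectField K] {A : AmbientDatum p K} {n : ℕ}
    (h : HatStableTowerLEOn 𝒞 IsEdgeData b A n) : CoreFocusExistsOn 𝒞 IsEdgeData A n :=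
  coreFocusExistsOn_of_uscCut_of_stableTowerLE (hatUscCutOn_of_invmaxClosed hW31 K A n) h

/-- Monotonicity in the class and the bound. [folklore] -/
theorem hatStableTowerLEOn_mono {𝒟 : ∀ ⦃W : Scheme.{u}⦄, IdealExponent W → Set W → Prop} (hle : ∀ ⦃W⦄ (F : IdealExponent W) (S : Set W), 𝒞 F S → 𝒟 F S)
    {b b' : ℕ} (hbb : b ≤ b') {p : ℕ} [Fact p.Prime] {K : Type u} [Field K] [CharP K p] [PerfectField K] {A : AmbientDatum p K}
    {n : ℕ} (h : HatStableTowerLEOn 𝒟 IsEdgeData b A n) : HatStableTowerLEOn 𝒞 IsEdgeData b' A n := by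
  intro E ed hE hb hed hC
  obtain ⟨b₀, hb₀, hle₀, hst⟩ := h E ed hE hb hed (hle _ _ hC)
  exact ⟨b₀, hb₀, hle₀.trans hbb, hst⟩

/-- Monotonicity of the apex in the class. [folklore] -/
theorem coreFocusExistsOn_mono {𝒟 : ∀ ⦃W : Scheme.{u}⦄, IdealExponent W → Set W → Prop} (hle : ∀ ⦃W⦄ (F : IdealExponent W) (S : Set W), 𝒞 F S → 𝒟 F S)
    {p : ℕ} [Fact p.Prime] {K : Type u} [Field K] [CharP K p] [PerfectField K] {A : AmbientDatum p K} {n : ℕ}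
    (h : CoreFocusExistsOn 𝒟 IsEdgeData A n) : CoreFocusExistsOn 𝒞 IsEdgeData A n :=
  fun E ed hE hb hed hC => h E ed hE hb hed (hle _ _ hC)

/-- The level-bounded class form implies the blanket residual's restriction: on the class `⊤`, `HatStableTowerLEOn ⊤ b ⇒
CampaignW31.HatStableTowerPos` (p485977). [folklore] -/
theorem hatStableTowerPos_of_hatStableTowerLEOn_univ {b : ℕ} {p : ℕ} [Fact p.Prime] {K : Type u} [Field K] [CharP K p]
    [PerfectField K] {A : AmbientDatum p K} {n : ℕ} (h : HatStableTowerLEOn (fun _ _ _ => True) IsEdgeData b A n) :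
    CampaignW31.HatStableTowerPos IsEdgeData A n := by
  intro E ed hE hb hed
  obtain ⟨b₀, hb₀, -, hst⟩ := h E ed hE hb hed trivial
  exact ⟨b₀, hb₀, hst⟩

/-- The apex on the class `⊤` is implied by the blanket apex `U30_2_R2_inst` GIVEN W3.1 (the guards «Sing(E)_cl ≠ ∅» / «Inv_max attained»
of row 010d are discharged as in p485977). [folklore] -/
theorem coreFocusExistsOn_of_U30_2_R2_inst (hW31 : CampaignW31InvmaxClosed.{u} IsEdgeData) {p : ℕ} [Fact p.Prime] {K : Type u}
    [Field K] [CharP K p] [PerfectField K] {A : AmbientDatum p K} {n : ℕ} (h : U30_2_R2_inst IsEdgeData A n) :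
    CoreFocusExistsOn 𝒞 IsEdgeData A n :=
  fun E ed hE hb hed _ =>
    (exists_isCoreFocus_iff_closure_ambient A (invInst (baseHike E) ed) (baseHike E) hb).mpr
      ((CampaignW31.U30_2_R2_inst_iff_hatStableCutPos_of_invmaxClosed hW31).mp h E ed hE hb hed)

end OnClass

/-! ## «Inv-constant centre data» is automatic from (43) -/

/-- On `Sing(Ě)_cl` the reading `Inv` is maximal on `Sing(Ê)_cl` — hence CONSTANT (`= Inv_max`) there: the «Inv-constant centre data» rider
of the director's shape is part of the typed (43) (`S06BaseHike.Eq43`, row 010), for any core focusing and any reading `inv`. [folklore] -/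
theorem inv_le_inv_of_mem_sing_coreFocus {Z : Scheme.{u}} {n : ℕ} {pAlg : IdealExponent Z → ℕ → Z.IdealSheafData}
    {inv : IdealExponent Z → Z → EdgeInv n} {Ehat Echeck : IdealExponent Z} (h : IsCoreFocus pAlg inv Ehat Echeck) {ξ : Z}
    (hξ : ξ ∈ Echeck.sing ∩ S02Preliminaries.closedPoints Z) :
    ξ ∈ Ehat.sing ∩ S02Preliminaries.closedPoints Z ∧ ∀ η ∈ Ehat.sing ∩ S02Preliminaries.closedPoints Z, inv Ehat η ≤ inv Ehat ξ := by
  rw [h.eq43.2] at hξ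
  exact hξ

/-- … so two points of `Sing(Ě)_cl` carry the SAME `Inv` key (constancy). [folklore] -/
theorem inv_key_eq_of_mem_sing_coreFocus {Z : Scheme.{u}} {n : ℕ} {pAlg : IdealExponent Z → ℕ → Z.IdealSheafData}
    {inv : IdealExponent Z → Z → EdgeInv n} {Ehat Echeck : IdealExponent Z} (h : IsCoreFocus pAlg inv Ehat Echeck) {ξ η : Z}
    (hξ : ξ ∈ Echeck.sing ∩ S02Preliminaries.closedPoints Z) (hη : η ∈ Echeck.sing ∩ S02Preliminaries.closedPoints Z) :
    (inv Ehat ξ).key = (inv Ehat η).key :=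
  le_antisymm ((inv_le_inv_of_mem_sing_coreFocus h hη).2 ξ (inv_le_inv_of_mem_sing_coreFocus h hξ).1)
    ((inv_le_inv_of_mem_sing_coreFocus h hξ).2 η (inv_le_inv_of_mem_sing_coreFocus h hη).1)

end CampaignW36

open CampaignW36

/-! ## Per-`p` slices at row 005 part b's provenance (class and bound stay parameters) -/

/-- **[OURS · L1 W3.6] `CampaignW36HatStableTowerLEOnI 𝒞 b p`** — `p`-slice of ⟨StableTower b₀ ≤ b⟩ on the class `𝒞` at
`CampaignW31.edgeDataProvenance`. Replaces the role of nothing printed; CANDIDATE premise = the W3.6 consumer target's content once `𝒞` is named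
(director 02:13:30Z: `b = 2`); NOT a statement of the manuscript. [folklore] -/
def CampaignW36HatStableTowerLEOnI (𝒞 : ∀ ⦃W : Scheme.{u}⦄, IdealExponent W → Set W → Prop) (b p : ℕ) [Fact p.Prime] : Prop :=
  ∀ (K : Type u) [Field K] [CharP K p] [PerfectField K] (A : AmbientDatum p K) (n : ℕ),
    HatStableTowerLEOn 𝒞 CampaignW31.edgeDataProvenance b A n

/-- **[OURS · L1 W3.6] `CampaignW36CoreFocusExistsOnI 𝒞 p`** — `p`-slice of the R12/12a apex on the class `𝒞` at `CampaignW31.edgeDataProvenance`: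
`Ě` exists for every standard `E` with `0 < Ê.b` and `𝒞 Ê`, every certified family. Replaces the role of p.30 l.5–9 on the class; NOT a
statement of the manuscript. [folklore] -/
def CampaignW36CoreFocusExistsOnI (𝒞 : ∀ ⦃W : Scheme.{u}⦄, IdealExponent W → Set W → Prop) (p : ℕ) [Fact p.Prime] : Prop :=
  ∀ (K : Type u) [Field K] [CharP K p] [PerfectField K] (A : AmbientDatum p K) (n : ℕ),
    CoreFocusExistsOn 𝒞 CampaignW31.edgeDataProvenance A n

/-- **[OURS · L1 W3.6 → D-lane] the apex on the class FROM THE SLOT STATEMENT and ⟨StableTower b₀ ≤ b⟩ on the class**: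
`CampaignW31UscInvOneExponentI p → CampaignW36HatStableTowerLEOnI 𝒞 b p → CampaignW36CoreFocusExistsOnI 𝒞 p`. [folklore] -/
theorem campaignW36CoreFocusExistsOnI_of_usc_of_stableTowerLEOnI (𝒞 : ∀ ⦃W : Scheme.{u}⦄, IdealExponent W → Set W → Prop) (b p : ℕ)
    [Fact p.Prime] (h₁ : CampaignW31UscInvOneExponentI.{u} p) (h₂ : CampaignW36HatStableTowerLEOnI.{u} 𝒞 b p) :
    CampaignW36CoreFocusExistsOnI.{u} 𝒞 p :=
  fun K _ _ _ A n =>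
    coreFocusExistsOn_of_uscCut_of_stableTowerLE (b := b)
      (hatUscCutOn_of_hatStratumClosedPos (campaignW31HatStratumClosedPosI_of_uscInvOneExponentI p h₁ K A n))
      (h₂ K A n)

end Summit.ResolutionOfSingularities.ResolutionOfSingularities.Theorems

end
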